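import Literature.RingTheory.FormalGroups.LazardTheorem
import Mathlib.Algebra.MvPolynomial.Eval
import HarnessLib

/-!
# Commutative one-dimensional formal group laws lift along surjections of rings (Lazard)
# ([Lazard1955] Théorème III and its corollary to Théorème II; [Hazewinkel1978] §5)

Topic `Literature/RingTheory/FormalGroups`; namespace `Literature.RingTheory.FormalGroups`.  THEOREMS ONLY; no definition, no
named fact, no instance, no notation, no `sorry`.

Since the Lazard ring is a POLYNOMIAL ring `ℤ[T₀, T₁, …]` (★ `LazardRing.equivMvPolynomial`, Lazard's Théorème II) and every
commutative law is a base change of the universal law over it (★ `LazardRing.exists_map_univLawPoly_eq`), a commutative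
one-dimensional formal group law over `A` LIFTS along any surjective ring map `π : A′ ↠ A`: lift the classifying map
`ℤ[T] → A` through `π` by freeness (`MvPolynomial.eval₂Hom` on chosen preimages) and push the universal law forward
(`exists_formalGroup_map_eq_of_surjective`).  In particular the moduli of commutative one-dimensional formal group laws is
formally smooth — the Lubin–Tate heart of the smoothness of the integral models in the P6 «MOD programme» (sub-line P6d,
head `FormalGroupLiftsAlongSurjection p`, whose hypothesis «`p` nilpotent in `A′`» is idle on this road).

## References
* [Lazard1955] M. Lazard, *Sur les groupes de Lie formels à un paramètre*, Bull. SMF 83 (1955), Théorèmes II–III (pp. 254–255).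
* [Hazewinkel1978] M. Hazewinkel, *Formal Groups and Applications* (1978), §5.
-/

noncomputable section

namespace Literature.RingTheory.FormalGroups

universe u v

/-- A ring map out of a polynomial ring over `ℤ` lifts along a surjection (freeness of `ℤ[T]`). [cite: Lazard1955, Théorème III] -/
theorem exists_ringHom_comp_eq_of_surjective {σ : Type*} {A' : Type u} {A : Type v} [CommRing A'] [CommRing A]
    (π : A' →+* A) (hπ : Function.Surjective π) (f : MvPolynomial σ ℤ →+* A) :
    ∃ f' : MvPolynomial σ ℤ →+* A', π.comp f' = f := by
  refine ⟨MvPolynomial.eval₂Hom (Int.castRingHom A') fun n => Function.surjInv hπ (f (MvPolynomial.X n)), ?_⟩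
  refine MvPolynomial.ringHom_ext (fun n => by simp) (fun n => ?_)
  simp [Function.surjInv_eq hπ]

/-- **Commutative one-dimensional formal group laws lift along surjective ring maps** (Lazard): for `π : A′ → A`
surjective and `G` a commutative law over `A` there is a commutative law `G′` over `A′` with `π_* G′ = G`.
[cite: Lazard1955, Théorème III] -/
theorem exists_formalGroup_map_eq_of_surjective {A' : Type u} {A : Type v} [CommRing A'] [CommRing A]
    (π : A' →+* A) (hπ : Function.Surjective π) (G : FormalGroup A) [G.IsComm] :
    ∃ G' : FormalGroup A', G'.IsComm ∧ G'.map π = G := by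
  obtain ⟨f, hf⟩ := LazardRing.exists_map_univLawPoly_eq G
  obtain ⟨f', hf'⟩ := exists_ringHom_comp_eq_of_surjective π hπ f
  refine ⟨LazardRing.univLawPoly.map f', ?_, ?_⟩
  · haveI := LazardRing.univLawPoly_isComm
    refine ⟨MvPowerSeries.ext fun d => ?_⟩
    change MvPowerSeries.coeff d (MvPowerSeries.map f' LazardRing.univLawPoly.toPowerSeries) =
      MvPowerSeries.coeff d (MvPowerSeries.subst _ (MvPowerSeries.map f' LazardRing.univLawPoly.toPowerSeries))
    rw [coeff_subst_swap, MvPowerSeries.coeff_map, MvPowerSeries.coeff_map, coeff_swapIdx_formalGroup]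
  · rw [LazardRing.map_map, hf', hf]

/-- The same with both rings in one universe and an idle nilpotence hypothesis, in the shape of the P6d head
`FormalGroupLiftsAlongSurjection p` (for every `p`). [cite: Lazard1955, Théorème III] -/
theorem formalGroup_liftsAlongSurjection (p : ℕ) (A' A : Type u) [CommRing A'] [CommRing A] (π : A' →+* A)
    (hπ : Function.Surjective π) (_hp : IsNilpotent (p : A')) (G : FormalGroup A) (hG : G.IsComm) :
    ∃ G' : FormalGroup A', G'.IsComm ∧ G'.map π = G := by
  haveI := hG
  exact exists_formalGroup_map_eq_of_surjective π hπ G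

/-- **Base change of commutative laws along a surjection is surjective** (restatement). [cite: Lazard1955, Théorème III] -/
theorem map_surjective_of_surjective {A' : Type u} {A : Type v} [CommRing A'] [CommRing A] (π : A' →+* A)
    (hπ : Function.Surjective π) :
    ∀ G : FormalGroup A, G.IsComm → ∃ G' : FormalGroup A', G'.IsComm ∧ G'.map π = G := fun G hG => by
  haveI := hG
  exact exists_formalGroup_map_eq_of_surjective π hπ G

end Literature.RingTheory.FormalGroups
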